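import Mathlib
import Summits.Ventures.PercRepro2.Defs
import Summits.Ventures.PercRepro2.Independence
import Summits.Ventures.PercRepro2.Harris
import Summits.Ventures.PercRepro2.ThreeEventSafe
import Summits.Ventures.PercRepro2.ThreeEventCross
import Summits.Ventures.PercRepro2.ThreeEventCertificate
import Summits.Ventures.PercRepro2.ThreeEventCertificateSwap
import Summits.Ventures.PercRepro2.ThreeEventCertificateInduction
import Summits.Ventures.PercRepro2.ThreeEventAD
import Summits.Ventures.PercRepro2.ThreeEventCertificateAD
import Summits.Ventures.PercRepro2.ThreeEventCertificateSections
import Summits.Ventures.PercRepro2.ThreeEventCertificateSectionsSum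

/-!
# The section form from the SUB-CUBE form (blind cell PercRepro2, p4 g34; proofs/P4-G34-SECTIONS.md Lemma 3.1,
the direction that feeds the kernel)

The hypothesis (∃-CERT-sec) of `cov_inter_le_cov_of_certificates_sec` asks, at every weight vector `p`, for
a certificate on the SUPPORT of `p`. Here it is derived from the SUB-CUBE statement (∃-CERT-sub): for every
nonempty set `U` of edges and every admissible quadruple on the cube `Config {e // e ∈ U}`, some edge of `U`
carries a finite-sum certificate on the whole of that cube (no weight vector, no support). The transport is
the one of Lemma 3.1: the support of `p` is the cube over the unpinned edges `U`, glued to the pinned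
configuration `σ_p`; the original quadruple RESTRICTS to an admissible quadruple of that cube
(`restrictSec`), and the certificate data on the cube EXTEND by cylinders (`cylinder'`) to admissible
quadruples / meet–join-closed AD quadruples of the full cube whose pair weights and AD terms at
configurations of the support are those of the originals at the restrictions. So the conjecture of
record becomes the per-cube statement (∃-CERT-sub), and `cov_inter_le_cov_of_certificates_cubes` is the
three-event lemma modulo it. Two definitions (`restrictSec`, `cylinder'`), no instance, no notation.
-/

namespace Summit.Ventures.PercRepro2

namespace ThreeEvent

section Transport

variable {E : Type*}

/-- The restriction of a configuration to the edges of `U`. -/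
def restrictTo (U : Finset E) (ω : Config E) : Config {e // e ∈ U} := fun i => ω i.1

/-- The cylinder over a set of configurations of the cube `U`: the configurations of `E` whose
restriction to `U` lies in the set. -/
def cylinder' (U : Finset E) (S : Set (Config {e // e ∈ U})) : Set (Config E) :=
  {ω | restrictTo U ω ∈ S}

/-- The restriction of an event of `E` to the section glued to the pinned configuration `τ` off `U`:
the configurations of the cube `U` which, completed by `τ` off `U`, lie in the event. -/
def restrictSec [DecidableEq E] (U : Finset E) (τ : {e // e ∉ (↑U : Set E)} → Bool) (S : Set (Config E)) :
    Set (Config {e // e ∈ U}) :=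
  {σ | glue (↑U : Set E) (fun i : {e // e ∈ (↑U : Set E)} => σ ⟨i.1, i.2⟩) τ ∈ S}

/-- Membership in a cylinder. -/
lemma mem_cylinder' (U : Finset E) (S : Set (Config {e // e ∈ U})) (ω : Config E) :
    ω ∈ cylinder' U S ↔ restrictTo U ω ∈ S := Iff.rfl

/-- Cylinders commute with intersections. -/
lemma cylinder'_inter (U : Finset E) (S T : Set (Config {e // e ∈ U})) :
    cylinder' U (S ∩ T) = cylinder' U S ∩ cylinder' U T := rfl

/-- Restriction is monotone. -/
lemma restrictTo_mono (U : Finset E) {ω ω' : Config E} (h : ω ≤ ω') :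
    restrictTo U ω ≤ restrictTo U ω' := fun i => h i.1

/-- The cylinder over an upper set is an upper set. -/
lemma isUpperSet_cylinder' (U : Finset E) {S : Set (Config {e // e ∈ U})} (hS : IsUpperSet S) :
    IsUpperSet (cylinder' U S) := fun _ _ h hω => hS (restrictTo_mono U h) hω

/-- The cylinder over a lower set is a lower set. -/
lemma isLowerSet_cylinder' (U : Finset E) {S : Set (Config {e // e ∈ U})} (hS : IsLowerSet S) :
    IsLowerSet (cylinder' U S) := fun _ _ h hω => hS (restrictTo_mono U h) hω

/-- Cylinders preserve inclusions. -/
lemma cylinder'_mono (U : Finset E) {S T : Set (Config {e // e ∈ U})} (h : S ⊆ T) :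
    cylinder' U S ⊆ cylinder' U T := fun _ hω => h hω

/-- Restriction commutes with meets. -/
lemma restrictTo_inf (U : Finset E) (a b : Config E) :
    restrictTo U (a ⊓ b) = restrictTo U a ⊓ restrictTo U b := rfl

/-- Restriction commutes with joins. -/
lemma restrictTo_sup (U : Finset E) (a b : Config E) :
    restrictTo U (a ⊔ b) = restrictTo U a ⊔ restrictTo U b := rfl

/-- Restriction commutes with updating an edge of `U`. -/
lemma restrictTo_update [DecidableEq E] (U : Finset E) (ω : Config E) (i : {e // e ∈ U}) (b : Bool) :
    restrictTo U (Function.update ω i.1 b) = Function.update (restrictTo U ω) i b := by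
  funext j
  by_cases h : j = i
  · subst h; simp [restrictTo]
  · have h' : j.1 ≠ i.1 := fun h'' => h (Subtype.ext h'')
    simp [restrictTo, Function.update_of_ne h, Function.update_of_ne h']

/-- The indicator of a cylinder is the indicator of the base set at the restriction. -/
lemma indicator_cylinder' {R : Type*} [CommRing R] (U : Finset E) (S : Set (Config {e // e ∈ U}))
    (ω : Config E) :
    (cylinder' U S).indicator (1 : Config E → R) ω = S.indicator 1 (restrictTo U ω) := by
  by_cases h : restrictTo U ω ∈ S
  · rw [Set.indicator_of_mem h, Set.indicator_of_mem ((mem_cylinder' U S ω).2 h)]; rfl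
  · rw [Set.indicator_of_notMem h, Set.indicator_of_notMem (fun h' => h ((mem_cylinder' U S ω).1 h'))]

/-- The pair weight of cylinders is the pair weight of the bases at the restrictions. -/
lemma pairWt_cylinder' {R : Type*} [CommRing R] (U : Finset E)
    (G H M B : Set (Config {e // e ∈ U})) (ω ω' : Config E) :
    (pairWt (cylinder' U G) (cylinder' U H) (cylinder' U M) (cylinder' U B) ω ω' : R)
      = pairWt G H M B (restrictTo U ω) (restrictTo U ω') := by
  unfold pairWt
  simp only [← cylinder'_inter, indicator_cylinder']

end Transport

section Glueing

variable {E : Type*} [Fintype E] [DecidableEq E] {R : Type*} [CommRing R] [LinearOrder R]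
  [IsStrictOrderedRing R]

/-- The pinned configuration of `p` off its unpinned edges: open where `p = 1`, closed otherwise. -/
noncomputable def pinnedConfig (p : E → R) : {e // e ∉ (↑(unpinned p) : Set E)} → Bool :=
  fun i => decide (p i.1 = 1)

omit [Fintype E] in
/-- On the support of `p`, a configuration is the glueing of its restriction to the unpinned edges
with the pinned configuration. -/
lemma glue_restrictTo_of_inSupport [Fintype E] {p : E → R} {ω : Config E} (hω : InSupport p ω) :
    glue (↑(unpinned p) : Set E)
        (fun i : {e // e ∈ (↑(unpinned p) : Set E)} => restrictTo (unpinned p) ω ⟨i.1, i.2⟩)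
        (pinnedConfig p) = ω := by
  funext e
  by_cases h : e ∈ (↑(unpinned p) : Set E)
  · rw [glue_apply_of_mem _ _ _ h]; rfl
  · rw [glue_apply_of_notMem _ _ _ h]
    simp only [pinnedConfig]
    have hpin : p e = 0 ∨ p e = 1 := by
      by_contra hcon
      apply h
      simp only [unpinned, Finset.coe_filter, Finset.mem_univ, true_and, Set.mem_setOf_eq]
      exact ⟨fun h0 => hcon (Or.inl h0), fun h1 => hcon (Or.inr h1)⟩
    rcases hpin with h0 | h1
    · have : ω e = false := (hω e).2 h0
      have hne : p e ≠ 1 := by rw [h0]; exact zero_ne_one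
      simp [this, hne]
    · have : ω e = true := (hω e).1 h1
      simp [this, h1]

omit [Fintype E] in
/-- Membership on the support, read through the restriction: `ω ∈ S ↔ restrictTo U ω ∈ restrictSec U σ_p S`. -/
lemma mem_restrictSec_iff [Fintype E] {p : E → R} {ω : Config E} (hω : InSupport p ω)
    (S : Set (Config E)) :
    restrictTo (unpinned p) ω ∈ restrictSec (unpinned p) (pinnedConfig p) S ↔ ω ∈ S := by
  unfold restrictSec
  rw [Set.mem_setOf_eq, glue_restrictTo_of_inSupport hω]

omit [Fintype E] [IsStrictOrderedRing R] in
/-- Updating an unpinned edge keeps a configuration on the support. -/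
lemma inSupport_update [Fintype E] {p : E → R} {ω : Config E} (hω : InSupport p ω) {e : E}
    (he : e ∈ unpinned p) (b : Bool) : InSupport p (Function.update ω e b) := by
  intro f
  by_cases hf : f = e
  · subst hf
    simp only [unpinned, Finset.mem_filter, Finset.mem_univ, true_and] at he
    exact ⟨fun h1 => absurd h1 he.2, fun h0 => absurd h0 he.1⟩
  · rw [Function.update_of_ne hf]; exact hω f

omit [Fintype E] in
/-- The restriction of a section is an upper set when the event is. -/
lemma isUpperSet_restrictSec [Fintype E] (U : Finset E) (τ : {e // e ∉ (↑U : Set E)} → Bool)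
    {S : Set (Config E)} (hS : IsUpperSet S) : IsUpperSet (restrictSec U τ S) := by
  intro σ σ' h hσ
  refine hS (fun e => ?_) hσ
  by_cases he : e ∈ (↑U : Set E)
  · rw [glue_apply_of_mem _ _ _ he, glue_apply_of_mem _ _ _ he]; exact h ⟨e, he⟩
  · rw [glue_apply_of_notMem _ _ _ he, glue_apply_of_notMem _ _ _ he]

omit [Fintype E] in
/-- The restriction of a section is a lower set when the event is. -/
lemma isLowerSet_restrictSec [Fintype E] (U : Finset E) (τ : {e // e ∉ (↑U : Set E)} → Bool)
    {S : Set (Config E)} (hS : IsLowerSet S) : IsLowerSet (restrictSec U τ S) := by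
  intro σ σ' h hσ
  refine hS (fun e => ?_) hσ
  by_cases he : e ∈ (↑U : Set E)
  · rw [glue_apply_of_mem _ _ _ he, glue_apply_of_mem _ _ _ he]; exact h ⟨e, he⟩
  · rw [glue_apply_of_notMem _ _ _ he, glue_apply_of_notMem _ _ _ he]

omit [Fintype E] in
/-- Restricting a section preserves inclusions. -/
lemma restrictSec_mono [Fintype E] (U : Finset E) (τ : {e // e ∉ (↑U : Set E)} → Bool)
    {S T : Set (Config E)} (h : S ⊆ T) : restrictSec U τ S ⊆ restrictSec U τ T :=
  fun _ hσ => h hσ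

omit [Fintype E] in
/-- Restricting a section commutes with intersections. -/
lemma restrictSec_inter [Fintype E] (U : Finset E) (τ : {e // e ∉ (↑U : Set E)} → Bool)
    (S T : Set (Config E)) : restrictSec U τ (S ∩ T) = restrictSec U τ S ∩ restrictSec U τ T := rfl

end Glueing

section Cubes

variable {E : Type*} [Fintype E] [DecidableEq E] {R : Type*} [CommRing R] [LinearOrder R]
  [IsStrictOrderedRing R]

/-- **The section form from the sub-cube form.** If every nonempty set `U` of edges and every
admissible quadruple on the cube over `U` has an edge of `U` with a finite-sum certificate on that cube,
then the section hypothesis of `cov_inter_le_cov_of_certificates_sec` holds on `E`. -/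
theorem certificates_sec_of_cubes
    (hcube : ∀ U : Finset E, U.Nonempty →
      ∀ (G H M B : Set (Config {e // e ∈ U})),
        (IsUpperSet G ∧ IsUpperSet H ∧ IsUpperSet M ∧ IsLowerSet B ∧ M ⊆ G ∧ G ∩ B ⊆ M) →
        ∃ e : {e // e ∈ U}, ∃ (k m : ℕ) (G₁ H₁ M₁ B₁ : Fin k → Set (Config {e // e ∈ U}))
          (l : Fin k → R) (X Y C D : Fin m → Set (Config {e // e ∈ U})) (μ : Fin m → R),
          (∀ i, IsUpperSet (G₁ i) ∧ IsUpperSet (H₁ i) ∧ IsUpperSet (M₁ i) ∧ IsLowerSet (B₁ i)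
            ∧ M₁ i ⊆ G₁ i ∧ G₁ i ∩ B₁ i ⊆ M₁ i) ∧ (∀ i, 0 ≤ l i) ∧ (∀ j, 0 ≤ μ j) ∧
          (∀ j, ∀ a ∈ X j, ∀ b ∈ Y j, a ⊓ b ∈ C j ∧ a ⊔ b ∈ D j) ∧
          ∀ ω ω' : Config {e // e ∈ U}, ω e = true → ω' e = true →
            (∑ i, l i * (pairWt (G₁ i) (H₁ i) (M₁ i) (B₁ i) ω ω'
                + pairWt (G₁ i) (H₁ i) (M₁ i) (B₁ i) ω' ω))
              + (∑ j, μ j * (((D j).indicator (1 : Config {e // e ∈ U} → R) ω * (C j).indicator 1 ω'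
                                - (X j).indicator (1 : Config {e // e ∈ U} → R) ω * (Y j).indicator 1 ω')
                              + ((D j).indicator (1 : Config {e // e ∈ U} → R) ω' * (C j).indicator 1 ω
                                - (X j).indicator (1 : Config {e // e ∈ U} → R) ω' * (Y j).indicator 1 ω)))
              ≤ (pairWt G H M B (Function.update ω e false) ω'
                  + pairWt G H M B ω (Function.update ω' e false))
                + (pairWt G H M B (Function.update ω' e false) ω
                  + pairWt G H M B ω' (Function.update ω e false))) :
    ∀ (G H M B : Set (Config E)),
      (IsUpperSet G ∧ IsUpperSet H ∧ IsUpperSet M ∧ IsLowerSet B ∧ M ⊆ G ∧ G ∩ B ⊆ M) →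
      ∀ p : E → R, IsProbVec p → (unpinned p).Nonempty →
        ∃ e ∈ unpinned p, ∃ (k m : ℕ) (G₁ H₁ M₁ B₁ : Fin k → Set (Config E)) (l : Fin k → R)
          (X Y C D : Fin m → Set (Config E)) (μ : Fin m → R),
          (∀ i, IsUpperSet (G₁ i) ∧ IsUpperSet (H₁ i) ∧ IsUpperSet (M₁ i) ∧ IsLowerSet (B₁ i)
            ∧ M₁ i ⊆ G₁ i ∧ G₁ i ∩ B₁ i ⊆ M₁ i) ∧ (∀ i, 0 ≤ l i) ∧ (∀ j, 0 ≤ μ j) ∧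
          (∀ j, ∀ a ∈ X j, ∀ b ∈ Y j, a ⊓ b ∈ C j ∧ a ⊔ b ∈ D j) ∧
          ∀ ω ω' : Config E, InSupport p ω → InSupport p ω' → ω e = true → ω' e = true →
            (∑ i, l i * (pairWt (G₁ i) (H₁ i) (M₁ i) (B₁ i) ω ω'
                + pairWt (G₁ i) (H₁ i) (M₁ i) (B₁ i) ω' ω))
              + (∑ j, μ j * (((D j).indicator (1 : Config E → R) ω * (C j).indicator 1 ω'
                                - (X j).indicator (1 : Config E → R) ω * (Y j).indicator 1 ω')
                              + ((D j).indicator (1 : Config E → R) ω' * (C j).indicator 1 ω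
                                - (X j).indicator (1 : Config E → R) ω' * (Y j).indicator 1 ω)))
              ≤ (pairWt G H M B (Function.update ω e false) ω'
                  + pairWt G H M B ω (Function.update ω' e false))
                + (pairWt G H M B (Function.update ω' e false) ω
                  + pairWt G H M B ω' (Function.update ω e false)) := by
  intro G H M B hadm p _hp hne
  classical
  set U := unpinned p with hU
  set τ := pinnedConfig p with hτ
  -- the restricted quadruple is admissible on the cube over `U`
  have hadm' : IsUpperSet (restrictSec U τ G) ∧ IsUpperSet (restrictSec U τ H)
      ∧ IsUpperSet (restrictSec U τ M) ∧ IsLowerSet (restrictSec U τ B)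
      ∧ restrictSec U τ M ⊆ restrictSec U τ G
      ∧ restrictSec U τ G ∩ restrictSec U τ B ⊆ restrictSec U τ M :=
    ⟨isUpperSet_restrictSec U τ hadm.1, isUpperSet_restrictSec U τ hadm.2.1,
      isUpperSet_restrictSec U τ hadm.2.2.1, isLowerSet_restrictSec U τ hadm.2.2.2.1,
      restrictSec_mono U τ hadm.2.2.2.2.1,
      by rw [← restrictSec_inter]; exact restrictSec_mono U τ hadm.2.2.2.2.2⟩
  obtain ⟨e', k, m, G₁, H₁, M₁, B₁, l, X, Y, C, D, μ, hP₁, hl, hμ, hAD, hpt⟩ :=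
    hcube U hne (restrictSec U τ G) (restrictSec U τ H) (restrictSec U τ M) (restrictSec U τ B) hadm'
  refine ⟨e'.1, e'.2, k, m, fun i => cylinder' U (G₁ i), fun i => cylinder' U (H₁ i),
    fun i => cylinder' U (M₁ i), fun i => cylinder' U (B₁ i), l,
    fun j => cylinder' U (X j), fun j => cylinder' U (Y j), fun j => cylinder' U (C j),
    fun j => cylinder' U (D j), μ, ?_, hl, hμ, ?_, ?_⟩
  · intro i
    exact ⟨isUpperSet_cylinder' U (hP₁ i).1, isUpperSet_cylinder' U (hP₁ i).2.1,
      isUpperSet_cylinder' U (hP₁ i).2.2.1, isLowerSet_cylinder' U (hP₁ i).2.2.2.1,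
      cylinder'_mono U (hP₁ i).2.2.2.2.1,
      by rw [← cylinder'_inter]; exact cylinder'_mono U (hP₁ i).2.2.2.2.2⟩
  · intro j a ha b hb
    have := hAD j (restrictTo U a) ha (restrictTo U b) hb
    exact ⟨by rw [mem_cylinder', restrictTo_inf]; exact this.1,
      by rw [mem_cylinder', restrictTo_sup]; exact this.2⟩
  · intro ω ω' hω hω' he he'
    have key := hpt (restrictTo U ω) (restrictTo U ω') he he'
    -- the certificate sums at the cylinders are the sums at the restrictions
    have hL : (∑ i, l i * (pairWt (cylinder' U (G₁ i)) (cylinder' U (H₁ i)) (cylinder' U (M₁ i))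
          (cylinder' U (B₁ i)) ω ω'
          + pairWt (cylinder' U (G₁ i)) (cylinder' U (H₁ i)) (cylinder' U (M₁ i))
          (cylinder' U (B₁ i)) ω' ω))
        + (∑ j, μ j * (((cylinder' U (D j)).indicator (1 : Config E → R) ω
                          * (cylinder' U (C j)).indicator 1 ω'
                        - (cylinder' U (X j)).indicator (1 : Config E → R) ω
                          * (cylinder' U (Y j)).indicator 1 ω')
                      + ((cylinder' U (D j)).indicator (1 : Config E → R) ω'
                          * (cylinder' U (C j)).indicator 1 ω
                        - (cylinder' U (X j)).indicator (1 : Config E → R) ω'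
                          * (cylinder' U (Y j)).indicator 1 ω)))
        = (∑ i, l i * (pairWt (G₁ i) (H₁ i) (M₁ i) (B₁ i) (restrictTo U ω) (restrictTo U ω')
            + pairWt (G₁ i) (H₁ i) (M₁ i) (B₁ i) (restrictTo U ω') (restrictTo U ω)))
          + (∑ j, μ j * (((D j).indicator (1 : Config {e // e ∈ U} → R) (restrictTo U ω)
                            * (C j).indicator 1 (restrictTo U ω')
                          - (X j).indicator (1 : Config {e // e ∈ U} → R) (restrictTo U ω)
                            * (Y j).indicator 1 (restrictTo U ω'))
                        + ((D j).indicator (1 : Config {e // e ∈ U} → R) (restrictTo U ω')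
                            * (C j).indicator 1 (restrictTo U ω)
                          - (X j).indicator (1 : Config {e // e ∈ U} → R) (restrictTo U ω')
                            * (Y j).indicator 1 (restrictTo U ω)))) := by
      simp only [pairWt_cylinder', indicator_cylinder']
    -- the cross pair weights of the original quadruple at the support are those of the restriction
    have hR : ∀ (a b : Config E), InSupport p a → InSupport p b →
        (pairWt G H M B a b : R)
          = pairWt (restrictSec U τ G) (restrictSec U τ H) (restrictSec U τ M) (restrictSec U τ B)
              (restrictTo U a) (restrictTo U b) := by
      intro a b ha hb
      unfold pairWt
      have hi : ∀ (S : Set (Config E)) (c : Config E), InSupport p c →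
          S.indicator (1 : Config E → R) c = (restrictSec U τ S).indicator 1 (restrictTo U c) := by
        intro S c hc
        by_cases hS : c ∈ S
        · rw [Set.indicator_of_mem hS, Set.indicator_of_mem ((mem_restrictSec_iff hc S).2 hS)]; rfl
        · rw [Set.indicator_of_notMem hS,
            Set.indicator_of_notMem (fun h' => hS ((mem_restrictSec_iff hc S).1 h'))]
      simp only [← restrictSec_inter, hi _ _ ha, hi _ _ hb]
    have hu : InSupport p (Function.update ω e'.1 false) := inSupport_update hω e'.2 false
    have hu' : InSupport p (Function.update ω' e'.1 false) := inSupport_update hω' e'.2 false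
    rw [hL, hR _ _ hu hω', hR _ _ hω hu', hR _ _ hu' hω, hR _ _ hω' hu,
      restrictTo_update, restrictTo_update]
    exact key

/-- **The three-event lemma modulo the sub-cube statement (∃-CERT-sub)**: if every nonempty set of
edges `U` and every admissible quadruple on the cube over `U` has an edge of `U` with a finite-sum
certificate on that cube, then `Cov_p(M, B ∩ H) ≤ Cov_p(G, H)` for every admissible quadruple on `E` and
every admissible weight vector. -/
theorem cov_inter_le_cov_of_certificates_cubes
    (hcube : ∀ U : Finset E, U.Nonempty →
      ∀ (G H M B : Set (Config {e // e ∈ U})),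
        (IsUpperSet G ∧ IsUpperSet H ∧ IsUpperSet M ∧ IsLowerSet B ∧ M ⊆ G ∧ G ∩ B ⊆ M) →
        ∃ e : {e // e ∈ U}, ∃ (k m : ℕ) (G₁ H₁ M₁ B₁ : Fin k → Set (Config {e // e ∈ U}))
          (l : Fin k → R) (X Y C D : Fin m → Set (Config {e // e ∈ U})) (μ : Fin m → R),
          (∀ i, IsUpperSet (G₁ i) ∧ IsUpperSet (H₁ i) ∧ IsUpperSet (M₁ i) ∧ IsLowerSet (B₁ i)
            ∧ M₁ i ⊆ G₁ i ∧ G₁ i ∩ B₁ i ⊆ M₁ i) ∧ (∀ i, 0 ≤ l i) ∧ (∀ j, 0 ≤ μ j) ∧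
          (∀ j, ∀ a ∈ X j, ∀ b ∈ Y j, a ⊓ b ∈ C j ∧ a ⊔ b ∈ D j) ∧
          ∀ ω ω' : Config {e // e ∈ U}, ω e = true → ω' e = true →
            (∑ i, l i * (pairWt (G₁ i) (H₁ i) (M₁ i) (B₁ i) ω ω'
                + pairWt (G₁ i) (H₁ i) (M₁ i) (B₁ i) ω' ω))
              + (∑ j, μ j * (((D j).indicator (1 : Config {e // e ∈ U} → R) ω * (C j).indicator 1 ω'
                                - (X j).indicator (1 : Config {e // e ∈ U} → R) ω * (Y j).indicator 1 ω')
                              + ((D j).indicator (1 : Config {e // e ∈ U} → R) ω' * (C j).indicator 1 ω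
                                - (X j).indicator (1 : Config {e // e ∈ U} → R) ω' * (Y j).indicator 1 ω)))
              ≤ (pairWt G H M B (Function.update ω e false) ω'
                  + pairWt G H M B ω (Function.update ω' e false))
                + (pairWt G H M B (Function.update ω' e false) ω
                  + pairWt G H M B ω' (Function.update ω e false)))
    {G H M B : Set (Config E)} (hG : IsUpperSet G) (hH : IsUpperSet H) (hM : IsUpperSet M)
    (hB : IsLowerSet B) (hMG : M ⊆ G) (hGB : G ∩ B ⊆ M) {p : E → R} (hp : IsProbVec p) :
    prob p (M ∩ (B ∩ H)) - prob p M * prob p (B ∩ H) ≤ prob p (G ∩ H) - prob p G * prob p H :=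
  cov_inter_le_cov_of_certificates_sec (certificates_sec_of_cubes hcube) hG hH hM hB hMG hGB hp

end Cubes

end ThreeEvent

end Summit.Ventures.PercRepro2
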